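import Summits.ABC.IUTFork.Joshi.RosettaFragment1Witness
import Summits.ABC.IUTFork.Joshi.RosettaFragment3OfHolIntegers
import Summits.ABC.IUTFork.Joshi.RosettaFrobenioidBridge

/-!
# NON-VACUITY WITNESS for Rosetta Stone Fragment 3: the signature `StripDatum` is inhabited at `(ℚ_p, ℂ_p)` —
# `G_{ℚ_p;ℂ_p} ↷ ℚ̄_p ⊂ ℂ_p`, `|−|_{ℂ_p}`, Tate parameter `q := p` — with every field PROVED, no side taken

abc-iut cell, branch E (rung LADDER-ABC:A2.E), seat abc-iut-E-t17 (AUTHORS-FIRST non-vacuity witness for my own interface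
structures `StripDatum` / `TateSupplement` of `Joshi/RosettaFragment3.lean` p428939 and `Joshi/RosettaFragment3OfHol.lean`
p430956, E-plan-2 ruling 08:35Z; E-t16's Fragment-1 witness `Rosetta.padicLocalHolDatum` p431739 is the input). K. Joshi,
*Construction of Arithmetic Teichmüller Spaces III*, arXiv 2401.13508 **v4** §8.5–§8.6 (bib `Joshi2024ATS3`, UNREFEREED,
typed AS A CANDIDATE, D-0012; typed ≠ proved ≠ endorsed; a model EXHIBITS satisfiability of a typed signature, nothing more;
nothing here asserts abc or [IUTchIII] Cor. 3.12 — no side taken on it or on any author).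

THE WITNESS. `L_v := ℚ_p`, `K_v := ℂ_p` (E-t1's untilt `Untilt.padicComplex p` through E-t16's reducible `padicUntilt p`),
`L̄_{v;K_v} :=` the algebraic closure of `ℚ_p` in `ℂ_p`, `G := G_{ℚ_p;ℂ_p} = Gal(L̄_{v;K_v}/ℚ_p)`, `Π := G` with the identity
augmentation (E-t16's DEGENERATE «no curve» choice — Fragment 3 records only `Π ↠ G`; the tempered fundamental group of an
actual curve is not constructed in Mathlib), the valuation `‖−‖_{ℂ_p}`, and as Tate quasi-period `q := p ∈ ℚ_p`
(`0 < ‖p‖ = p⁻¹ < 1`; ANY `q` with `0 < ‖q‖ < 1` inhabits the signature — that `p` is the Tate parameter of a specific Tate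
curve over `ℚ_p` is NOT claimed; §8.6 p.83 l.45 – p.84 l.2 only uses `q ∈ L_v`, `0 < |q| < 1`), `ℓ` arbitrary. The one
non-bookkeeping field of the supplement — the `G_{ℚ_p;ℂ_p}`-invariance of `‖−‖_{ℂ_p}` on `ℚ̄_p` (`StripDatum.abs_gal`) — is
PROVED, not assumed: `TateSupplement.ofComplete` (T-17 p430956, `norm_gal_of_complete` via Mathlib's spectral norm) applies
because `ℚ_p` is complete and `ℚ_p ↪ ℂ_p` is an isometry (Mathlib `PadicComplex.norm_extends'`).

PROVED ABOUT THE WITNESS (instances of the T-17 / E-t45 / E-t32–E-t34-bridge theorems, so none of them is about an empty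
type): `|q|_{K_v} = p⁻¹` and `log|q| = −log p < 0` (the realified strip's pilot degree, (8.6.1.1)); `O^▷_{ℚ̄_p}` (Fragment 3's
norm cut) `= 𝒪^⊳_{ℚ̄_p}` (Fragment 1's integral closure; E-t45's `oTriEqNonzeroIntegers_holds`, p432619); the Frobenioid of the
realified strip `Frob(ℚ̄_p ⊂ ℂ_p, ‖−‖)` has PERFECT divisor group (Prop. 10.4.1.1 (1); `isPerfectDiv_ofLocalHol`, p433463) and
its Tate parameter has degree `−log p`. Standard axioms only; sorry-free; no instance / notation / claim-Prop declared.
[claim: Joshi2024ATS3, status: disputed]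
-/

noncomputable section

open scoped ValuativeRel

namespace Summit.ABC.IUTFork.Joshi.ATS3

open Summit.ABC.IUTFork.Joshi.Rosetta
open Literature.AnabelianGeometry.AbsoluteAnabelian (nonzeroIntegers)

variable (p : ℕ) [Fact p.Prime]

/-- `ℚ_p ↪ ℂ_p` is an isometry (Mathlib `PadicComplex.norm_extends'`), in the `algebraMap` form the Fragment-1/3 structures
use. [folklore] -/
theorem norm_algebraMap_padicUntilt (x : ℚ_[p]) : ‖algebraMap ℚ_[p] (padicUntilt p).K x‖ = ‖x‖ :=
  PadicComplex.norm_extends' p x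

/-- `0 < ‖p‖_{ℂ_p}`. [folklore] -/
theorem norm_algebraMap_padicUntilt_p_pos : 0 < ‖algebraMap ℚ_[p] (padicUntilt p).K (p : ℚ_[p])‖ := by
  rw [norm_algebraMap_padicUntilt, Padic.norm_p]
  exact inv_pos.2 (by exact_mod_cast (Fact.out : p.Prime).pos)

/-- `‖p‖_{ℂ_p} < 1`. [folklore] -/
theorem norm_algebraMap_padicUntilt_p_lt_one : ‖algebraMap ℚ_[p] (padicUntilt p).K (p : ℚ_[p])‖ < 1 := by
  rw [norm_algebraMap_padicUntilt]
  exact Padic.norm_p_lt_one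

/-- CONSTRUCTED — **the Fragment-3 supplement at `(ℚ_p, ℂ_p)`**: `q := p`, `0 < ‖p‖_{ℂ_p} < 1`, `ℓ` given, and the
Galois-invariance of `‖−‖_{ℂ_p}` on `ℚ̄_p` PROVED (`TateSupplement.ofComplete`: `ℚ_p` complete, `ℚ_p ↪ ℂ_p` isometric).
[claim: Joshi2024ATS3, status: disputed] -/
def padicTateSupplement (ell : ℕ) : TateSupplement ℚ_[p] (padicUntilt p) :=
  TateSupplement.ofComplete (padicUntilt p) (p : ℚ_[p]) (norm_algebraMap_padicUntilt_p_pos p)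
    (norm_algebraMap_padicUntilt_p_lt_one p) ell (norm_algebraMap_padicUntilt p)

/-- CONSTRUCTED — **Rosetta Stone Fragment 3's signature is inhabited**: the `StripDatum` at `L_v = ℚ_p`, `K_v = ℂ_p`,
`L̄_v = ℚ̄_p ⊂ ℂ_p`, `G = Π = G_{ℚ_p;ℂ_p}`, `|−| = ‖−‖_{ℂ_p}`, `q = p` — T-17's `StripDatum.ofLocalHol` on E-t16's witness
`padicLocalHolDatum` and the supplement above. [claim: Joshi2024ATS3, status: disputed] -/
def padicStripDatum (ell : ℕ) :
    StripDatum (PrefGal ℚ_[p] ℂ_[p]) (PrefGal ℚ_[p] ℂ_[p]) (PrefAlgClosure ℚ_[p] ℂ_[p]) ℂ_[p] :=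
  StripDatum.ofLocalHol (padicLocalHolDatum p) (padicTateSupplement p ell)

/-- PROVED — NON-VACUITY: the type of Fragment-3 data at `(ℚ_p, ℂ_p)` is nonempty, so the Fragment-3 rows (`stripHol`, `stripMono`,
`stripTimes`, `stripTimesMu` (8.6.3), `stripTriTimesMu` (8.6.5), `stripTri`, `stripPerp`), the realified strips (8.6.1.1) and
every theorem of T-17 / the bridges over `StripDatum` speak about an inhabited signature. [folklore] -/
theorem nonempty_stripDatum_padic (ell : ℕ) :
    Nonempty (StripDatum (PrefGal ℚ_[p] ℂ_[p]) (PrefGal ℚ_[p] ℂ_[p]) (PrefAlgClosure ℚ_[p] ℂ_[p]) ℂ_[p]) :=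
  ⟨padicStripDatum p ell⟩

/-- The witness's Tate parameter is `p`. [folklore] -/
theorem padicStripDatum_q (ell : ℕ) :
    (padicStripDatum p ell).q = algebraMap ℚ_[p] (PrefAlgClosure ℚ_[p] ℂ_[p]) (p : ℚ_[p]) := rfl

/-- PROVED: `|q|_{K_v} = p⁻¹` at the witness («calculate the absolute value of the Tate parameter», (8.6.1.1) p.84 l.36–38).
[folklore] -/
theorem padicStripDatum_absTate (ell : ℕ) : (padicStripDatum p ell).absTate = (p : ℝ)⁻¹ := by
  rw [padicStripDatum, ofLocalHol_absTate]
  show ‖algebraMap ℚ_[p] (padicUntilt p).K (p : ℚ_[p])‖ = _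
  rw [norm_algebraMap_padicUntilt, Padic.norm_p]

/-- PROVED: the realified strip's `q`-degree at the witness is `log|q| = −log p` … [folklore] -/
theorem padicStripDatum_log_absTate (ell : ℕ) : Real.log (padicStripDatum p ell).absTate = -Real.log p := by
  rw [padicStripDatum_absTate, Real.log_inv]

/-- … which is negative (instance of T-17's `log_absTate_neg`; here also directly: `p > 1`). [folklore] -/
theorem padicStripDatum_log_absTate_neg (ell : ℕ) : Real.log (padicStripDatum p ell).absTate < 0 :=
  (padicStripDatum p ell).log_absTate_neg

/-- PROVED (instance of E-t45's discharge p432619): at the witness, Fragment 3's norm cut `O^▷_{ℚ̄_p} = {x ≠ 0, ‖x‖_{ℂ_p} ≤ 1}`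
IS Fragment 1's integral-closure monoid `𝒪^⊳_{ℚ̄_p}` (the tree's `PadicAlgCl.isIntegral_iff_norm_le_one` phenomenon, now for
the algebraic closure of `ℚ_p` INSIDE `ℂ_p`). [folklore] -/
theorem padicStripDatum_OTri_eq_nonzeroIntegers (ell : ℕ) :
    (padicStripDatum p ell).OTri = nonzeroIntegers ℚ_[p] (PrefAlgClosure ℚ_[p] ℂ_[p]) :=
  ofLocalHol_OTri_eq_nonzeroIntegers (padicLocalHolDatum p) (padicTateSupplement p ell)

/-- PROVED (instance of the bridge p433463, Prop. 10.4.1.1 (1)): the Frobenioid of the realified strip at the witness,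
`Frob(ℚ̄_p ⊂ ℂ_p, ‖−‖)`, has PERFECT divisor group — unconditionally. [folklore] -/
theorem padicStripDatum_isPerfectDiv (ell : ℕ) : Frob.IsPerfectDiv (padicStripDatum p ell).absL :=
  isPerfectDiv_ofLocalHol (padicLocalHolDatum p) (padicTateSupplement p ell)

/-- PROVED (instance of the bridge p433463): in that Frobenioid the Tate parameter has degree `log ‖p‖_{ℂ_p} = −log p`.
[folklore] -/
theorem padicStripDatum_degB_q (ell : ℕ) :
    ((padicStripDatum p ell).frobenioid.degB (padicStripDatum p ell).qUnit).toAdd = -Real.log p := by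
  rw [StripDatum.toAdd_degB_qUnit, padicStripDatum_log_absTate]

/-- PROVED — NON-VACUITY of the realified strip type (8.6.1.1): `F^{⊩▶×μ}_{Joshi}` at the witness. [folklore] -/
theorem nonempty_realified_padic :
    Nonempty (StripDatum.Realified.{1} (Literature.IUT.HodgeArakelov.CoveringMonoid (PrefGal ℚ_[p] ℂ_[p])) ℂ_[p]) :=
  ⟨(padicStripDatum p 1).stripVdashTriTimesMu⟩

end Summit.ABC.IUTFork.Joshi.ATS3

end
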